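import Summits.ResolutionOfSingularities.ResolutionOfSingularities.Theorems.RelativeDeltaCutKernels
import Summits.ResolutionOfSingularities.ResolutionOfSingularities.Theorems.MaxContactCutTauLadder
import Summits.ResolutionOfSingularities.ResolutionOfSingularities.Theorems.MaxContactCutGenericPointCut
import Summits.ResolutionOfSingularities.ResolutionOfSingularities.Theorems.MaxContactCutFaceFormCut
import Summits.ResolutionOfSingularities.ResolutionOfSingularities.Theorems.MaxContactCutVeryNearCut
import Summits.ResolutionOfSingularities.ResolutionOfSingularities.Theorems.MaxContactCutDeltaFaceCut
import HarnessLib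

/-!
# MaxContactCutRelativeDeltaCut — the decomp-res node «RelativeDeltaCut» BY NAME on the host route `MaxContactCut`
(lens-2 g12, sha256 29d33530a35d7692; critic row 85 CLEARED)

Tree file 3/3: EXACT AT THE RUNG `rungOne_iff : MaxContactCut.RungOne ⟺ RelGenericRung ∧ RelSpecialRung`
(29273), necessity by
letter, the honesty kernel, `closes`, `closes_of_engines`, `closes_of_columns`, `closes_of_leaves`,
`e_one_iff_families`, the MAP
EDGES to 28544 `StepPICoreDimFour` and 30461 `ClosedPointCoreAll`, and §7 the REFINEMENT EDGES to the tree asides 32106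
`VNGenericRung` / 32107 `VNSpecialRung` (g10), 31576 `FFGenericRung` / 31577 `FFSpecialRung` (g9) and g11's
`DeltaFaceCutClasses.DeltaGenericRung` / `DeltaSpecialRung` (tree; asides 33469/33470 `DFGenericRung`/`DFSpecialRung` unfold to
them) — VERBATIM.
(Sources: CossartJannsenSaito2020; Hironaka1964; CossartPiltant2019.)
-/

open CategoryTheory AlgebraicGeometry TopologicalSpace IsLocalRing
open Literature.AlgebraicGeometry.Resolution
open Summit.ResolutionOfSingularities.ResolutionOfSingularities.Theorems
open Summit.ResolutionOfSingularities.ResolutionOfSingularities.Theorems.WeakOrderReduction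
open Summit.ResolutionOfSingularities.ResolutionOfSingularities.Theorems.DeltaFaceCutClasses
open Summit.ResolutionOfSingularities.ResolutionOfSingularities.Theses

namespace Summit.ResolutionOfSingularities.ResolutionOfSingularities.Theorems.RelativeDeltaCut

section Kernels

variable {n : ℕ}

/-- **EXACT AT THE RUNG**: `RungOne ⟺ RelGenericRung ∧ RelSpecialRung` (marking by marking). [folklore] -/
theorem rungOne_iff : MaxContactCut.RungOne ↔ RelGenericRung ∧ RelSpecialRung := by
  constructor
  · intro h
    exact ⟨fun hE2 n hn => seqRGen_of_seqDimFour_one (h hE2 n hn),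
      fun hE2 n hn => seqRSpec_of_seqDimFour_one (h hE2 n hn)⟩
  · rintro ⟨hG, hS⟩ hE2 n hn
    exact seqDimFour_one_iff.mpr ⟨hG hE2 n hn, hS hE2 n hn⟩

/-- NECESSITY by letter: the decided half is implied by the rung. [folklore] -/
theorem relGenericRung_of_rungOne (h : MaxContactCut.RungOne) : RelGenericRung := (rungOne_iff.mp h).1

/-- NECESSITY by letter: the located residual is implied by the rung. [folklore] -/
theorem relSpecialRung_of_rungOne (h : MaxContactCut.RungOne) : RelSpecialRung := (rungOne_iff.mp h).2

/-- HONESTY KERNEL: modulo the decided half, the located residual IS the rung. [folklore] -/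
theorem relSpecialRung_iff_rungOne (hG : RelGenericRung) : RelSpecialRung ↔ MaxContactCut.RungOne :=
  ⟨fun hS => rungOne_iff.mpr ⟨hG, hS⟩, relSpecialRung_of_rungOne⟩

/-- **DECIDING IMPLICATION OF THE NODE**: `MaxContactCut.RungOne` (29273) BY NAME from the two halves. [folklore] -/
theorem closes (hG : RelGenericRung) (hS : RelSpecialRung) : MaxContactCut.RungOne :=
  rungOne_iff.mpr ⟨hG, hS⟩

/-- `RungOne` BY NAME from the three ENGINES, the ports and the located residual. [folklore] -/
theorem closes_of_engines (hV : VeryNearCutClasses.VeryNearExit) (hD : DeltaPackageExit)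
    (hU : UniformCurvePackageExit) (hP : ∀ n : ℕ, 2 ≤ n → CurvePackagePort n)
    (h1 : FaceFormCutClasses.OrderOneContact) (hS : RelSpecialRung) : MaxContactCut.RungOne :=
  closes (relGenericRung_of_engines hV hD hU hP h1) hS

/-- The located residual split at the rung into the two isolation columns (EXACT). [folklore] -/
theorem relSpecialRung_iff_iso : RelSpecialRung ↔
    (E 2 → ∀ n : ℕ, 1 ≤ n → SeqRSpecNonIso n) ∧ (E 2 → ∀ n : ℕ, 1 ≤ n → SeqRSpecIso n) :=
  ⟨fun h => ⟨fun hE2 n hn => (seqRSpec_iff_iso.mp (h hE2 n hn)).1, fun hE2 n hn => (seqRSpec_iff_iso.mp (h hE2 n hn)).2⟩,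
    fun h hE2 n hn => seqRSpec_iff_iso.mpr ⟨h.1 hE2 n hn, h.2 hE2 n hn⟩⟩

/-- `RungOne` BY NAME from the decided half and the two isolation columns. [folklore] -/
theorem closes_of_columns (hG : RelGenericRung) (hN : E 2 → ∀ n : ℕ, 1 ≤ n → SeqRSpecNonIso n)
    (hI : E 2 → ∀ n : ℕ, 1 ≤ n → SeqRSpecIso n) : MaxContactCut.RungOne :=
  closes hG (relSpecialRung_iff_iso.mpr ⟨hN, hI⟩)

/-- The located residual split at the rung into the three LEAVES (CURVE, TANGLE, ISO) — EXACT. [folklore] -/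
theorem relSpecialRung_iff_leaves : RelSpecialRung ↔
    (E 2 → ∀ n : ℕ, 1 ≤ n → SeqRSpecCurve n) ∧ (E 2 → ∀ n : ℕ, 1 ≤ n → SeqRSpecTangle n) ∧
      (E 2 → ∀ n : ℕ, 1 ≤ n → SeqRSpecIso n) := by
  constructor
  · intro h
    refine ⟨fun hE2 n hn => ?_, fun hE2 n hn => ?_, fun hE2 n hn => (seqRSpec_iff_iso.mp (h hE2 n hn)).2⟩
    · exact (seqRSpecNonIso_iff.mp (seqRSpec_iff_iso.mp (h hE2 n hn)).1).1
    · exact (seqRSpecNonIso_iff.mp (seqRSpec_iff_iso.mp (h hE2 n hn)).1).2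
  · rintro ⟨hC, hT, hI⟩ hE2 n hn
    exact seqRSpec_of_leaves (hC hE2 n hn) (hT hE2 n hn) (hI hE2 n hn)

/-- `RungOne` BY NAME from the decided half and the three leaves. [folklore] -/
theorem closes_of_leaves (hG : RelGenericRung) (hC : E 2 → ∀ n : ℕ, 1 ≤ n → SeqRSpecCurve n)
    (hT : E 2 → ∀ n : ℕ, 1 ≤ n → SeqRSpecTangle n) (hI : E 2 → ∀ n : ℕ, 1 ≤ n → SeqRSpecIso n) :
    MaxContactCut.RungOne :=
  closes hG (relSpecialRung_iff_leaves.mpr ⟨hC, hT, hI⟩)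

/-- `E 1` ⟺ the two families at every marking (EXACT, family level). [folklore] -/
theorem e_one_iff_families : E 1 ↔ (∀ n : ℕ, 1 ≤ n → SeqRGen n) ∧ (∀ n : ℕ, 1 ≤ n → SeqRSpec n) :=
  ⟨fun h => ⟨fun n hn => seqRGen_of_seqDimFour_one (h n hn), fun n hn => seqRSpec_of_seqDimFour_one (h n hn)⟩,
    fun h n hn => seqDimFour_one_iff.mpr ⟨h.1 n hn, h.2 n hn⟩⟩

/-! ### Map edges BY NAME to the tree's located residuals -/

/-- MAP EDGE to the located core `MaxContactCut.StepPICoreDimFour` (28544) BY NAME, through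
`MaxContactCutTauLadder.closes`. [folklore] -/
theorem closes_core (h5 : MaxContactCutExhaustion.ContactOrderSequenceDimFour) (r4 : MaxContactCut.RungFour)
    (r3 : MaxContactCut.RungThree) (r2 : MaxContactCut.RungTwo) (hG : RelGenericRung) (hS : RelSpecialRung)
    (hSS : MaxContactCut.SequenceToStepAll) : MaxContactCut.StepPICoreDimFour :=
  (MaxContactCutTauLadder.closes h5 r4 r3 r2 (closes hG hS) hSS).2.2.2.2

/-- MAP EDGE to g7's located residual `MaxContactCut.ClosedPointCoreAll` (30461) BY NAME (the TANGLE / FLAT-δ material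
is Round material: given the rounds, the rung IS the closed-point core). [folklore] -/
theorem closes_closedPointCore (hE2 : E 2) (h2 : MaxContactCut.RoundCodimTwoAll)
    (h3 : MaxContactCut.RoundCodimThreeAll) (hG : RelGenericRung) (hS : RelSpecialRung) :
    MaxContactCut.ClosedPointCoreAll :=
  (MaxContactCutGenericPointCut.rungOne_iff_core_of_rounds hE2 h2 h3).mp (closes hG hS)

end Kernels

/-! ## §7  Refinement edges BY NAME to the tree's g10 asides 32106/32107, the g9 asides 31576/31577, and g11 -/

section Refinement

/-- **EDGE to 32106**: the decided half implies the tree's g10 decided aside `VNGenericRung`. [folklore] -/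
theorem vnGenericRung_of_relGenericRung (h : RelGenericRung) : MaxContactCut.VNGenericRung :=
  MaxContactCutVeryNearCut.vnGenericRung_iff.mpr fun hE2 n hn => seqNGen_of_seqRGen (h hE2 n hn)

/-- **EDGE to 31576** (through 32106 and the tree's g10 edge): the decided half implies the g9 decided aside. [folklore] -/
theorem ffGenericRung_of_relGenericRung (h : RelGenericRung) : MaxContactCut.FFGenericRung :=
  MaxContactCutVeryNearCut.ffGenericRung_of_vnGenericRung (vnGenericRung_of_relGenericRung h)

/-- **EDGE to g11**: the decided half implies g11's decided half `DeltaGenericRung` (restated). [folklore] -/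
theorem deltaGenericRung_of_relGenericRung (h : RelGenericRung) : DeltaGenericRung :=
  fun hE2 n hn => seqDGen_of_seqRGen (h hE2 n hn)

/-- **EDGE from 32107**: the tree's g10 located residual `VNSpecialRung` implies this node's located residual (the
residual SHRINKS by letter). [folklore] -/
theorem relSpecialRung_of_vnSpecialRung (h : MaxContactCut.VNSpecialRung) : RelSpecialRung :=
  fun hE2 n hn => seqRSpec_of_seqNSpec (MaxContactCutVeryNearCut.vnSpecialRung_iff.mp h hE2 n hn)

/-- **EDGE from 31577** (through the tree's g10 edge): the g9 located residual implies this node's. [folklore] -/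
theorem relSpecialRung_of_ffSpecialRung (h : MaxContactCut.FFSpecialRung) : RelSpecialRung :=
  relSpecialRung_of_vnSpecialRung (MaxContactCutVeryNearCut.vnSpecialRung_of_ffSpecialRung h)

/-- **EDGE from g11**: g11's located residual `DeltaSpecialRung` (restated) implies this node's. [folklore] -/
theorem relSpecialRung_of_deltaSpecialRung (h : DeltaSpecialRung) : RelSpecialRung :=
  fun hE2 n hn => seqRSpec_of_seqDSpec (h hE2 n hn)

/-- **EDGE from g11's NON-ISOLATED column** at the rung (the column this node cuts). [folklore] -/
theorem relSpecNonIso_of_deltaSpecNonIso (h : E 2 → ∀ n : ℕ, 1 ≤ n → SeqDSpecNonIso n) :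
    E 2 → ∀ n : ℕ, 1 ≤ n → SeqRSpecNonIso n :=
  fun hE2 n hn => seqRSpecNonIso_of_seqDSpecNonIso (h hE2 n hn)

/-- HONESTY: modulo the decided half, the tree's g10 located residual 32107 and this node's are EQUIVALENT — both are
the rung. [folklore] -/
theorem vnSpecialRung_iff_relSpecialRung (hG : RelGenericRung) :
    MaxContactCut.VNSpecialRung ↔ RelSpecialRung :=
  ⟨relSpecialRung_of_vnSpecialRung,
    fun hS => MaxContactCutVeryNearCut.nearSpecialRung_of_rungOne (closes hG hS)⟩

/-- HONESTY: modulo the decided half, the tree's g9 located residual 31577 and this node's are EQUIVALENT. [folklore] -/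
theorem ffSpecialRung_iff_relSpecialRung (hG : RelGenericRung) :
    MaxContactCut.FFSpecialRung ↔ RelSpecialRung :=
  ⟨relSpecialRung_of_ffSpecialRung,
    fun hS => MaxContactCutFaceFormCut.specialRung_of_rungOne (closes hG hS)⟩

/-- `RungOne` BY NAME from the decided half and the tree's g10 located residual 32107. [folklore] -/
theorem closes_of_vnSpecialRung (hG : RelGenericRung) (hS : MaxContactCut.VNSpecialRung) : MaxContactCut.RungOne :=
  closes hG (relSpecialRung_of_vnSpecialRung hS)

/-- `RungOne` BY NAME from the decided half and the tree's g9 located residual 31577. [folklore] -/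
theorem closes_of_ffSpecialRung (hG : RelGenericRung) (hS : MaxContactCut.FFSpecialRung) : MaxContactCut.RungOne :=
  closes hG (relSpecialRung_of_ffSpecialRung hS)

end Refinement

end Summit.ResolutionOfSingularities.ResolutionOfSingularities.Theorems.RelativeDeltaCut
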